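import Summits.ResolutionOfSingularities.ResolutionOfSingularities.Theorems.FrobeniusLadderFInjectiveMacaulayficationFInjectiveMacaulayficationOfChartModels
import Summits.ResolutionOfSingularities.ResolutionOfSingularities.Theorems.FrobeniusLadderFInjectiveMacaulayficationCICertificates
import HarnessLib

/-!
# The certified-chart class and the door corollary for c.i.-CN (toric / K-loc) chart models
# (crux `FInjectiveMacaulayfication`, road B «K-loc-Lean», ToricCertSig v12.1 §1 = (G1))

[OURS · L1 W4.5a · res-L1-w45a-stub-3] Support file (`--supports stmt-ResolutionOfSingularities-15315 --as helper`) for the crux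
`FrobeniusLadder.FInjectiveMacaulayfication`; NOT a statement of any manuscript; AI-written, weaker than expert review.
Planner sketch `L/w45a/ToricCertSig.lean` v1 = Sig v12.1 sha16 ab1a5003a935443d §1 `stub_certifiedChart_of_ciChart` (rulings
R12.11 (d), R12.12 (a)), typed VERBATIM with ONE added binder `(∀ a ∈ A, ∃ j ∈ J, 0 < a j)` right after `hprim` (objection posted
on HOME/STATUS 2026-08-27T08:4xZ: it is the hypothesis of `CICertificates.centre_le_iff`, without which `0 ∈ A` makes the centre the
unit ideal and the conclusion fails).

* `certifiedChart_of_ciChart` — **(G1) `P_cert` AT A CI-CHART POINT**: `X₁` integral; `b` closed and alone-F-bad in an open `V₀`; an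
  affine `U ∋ b` with `ε : Γ(X₁, U) ≃+* (k[X]/(Fs))[1/h]` (`h ≠ 0`) pulling the prime of `b` back to `(x̄₁, …, x̄ₙ)`; the binder block
  of `CICertificates.ciCertificates` (p507818, stub-1: monomial centre `I_A`, unimodular charts `V c`, vertices `m c`, strict
  transforms `gs c`, the naive-quotient chart clause `hon'`) + `hAJ` + the POINT-SUPPORT binder `hJ`. Proof =
  `OfChartModels.certifiedChart_of_cnChart`'s with `ciCertificates` for `cnCertificates` and the zero locus by
  `CICertificates.centre_le_iff` + `hJ`, through `CertifiedChartOfAwayChart.certifiedChart_of_awayChartEquiv` (p510104).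
* `fInjectiveMacaulayfication_of_ciChartModels` — the DOOR COROLLARY: an admissible pair each of whose bad points carries such a
  c.i.-CN away-chart (∃-packaged) has the crux's model — through `OfChartModels.fInjectiveMacaulayfication_of_certifiedAwayCharts`
  (p510814); ZERO named facts.

The hoff-free Spec-specimen adapter to `PFix` (road B's Lean target) is NOT `G1 ∘ 5d` (5d consumes admissibility and `P_cert`'s
alone-bad conjunct): it is `PointFixableOfCert.pointFixable_of_ciCert` (separate file, via the one-shot tower lemma).
-/

-- single-problem summit: the doubled namespace component is forced
set_option linter.dupNamespace false

noncomputable section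

namespace Summit.ResolutionOfSingularities.ResolutionOfSingularities.Theorems.FInjectiveMacaulayfication.OfCIChartModels

open AlgebraicGeometry CategoryTheory Literature.AlgebraicGeometry.Resolution TopologicalSpace MvPolynomial
open Summit.ResolutionOfSingularities.ResolutionOfSingularities.Theorems.FInjectiveMacaulayfication

set_option maxHeartbeats 800000 in
-- large binder block
/-- **(G1) `P_cert` AT A CI-CHART POINT** (ToricCertSig v12.1 ab1a5003a935443d §1, verbatim + the `hAJ` binder). [folklore] -/
theorem certifiedChart_of_ciChart : ∀ (p : ℕ) [Fact p.Prime] (k : Type) [Field k] [CharP k p] (X₁ : Scheme.{0}) [IsIntegral X₁]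
    (b : X₁), IsClosed ({b} : Set X₁) →
    ∀ (V₀ : X₁.Opens), b ∈ V₀ → (∀ x : X₁, x ∈ V₀ → x ≠ b → ∀ d : ℕ, ringKrullDim (X₁.presheaf.stalk x) = d → ∀ s : Fin d → X₁.presheaf.stalk x, (Ideal.span (Set.range s)).radical.IsMaximal → ∀ y : X₁.presheaf.stalk x, (∃ e : ℕ, y ^ p ^ e ∈ Ideal.span ((fun z : X₁.presheaf.stalk x => z ^ p ^ e) '' (Ideal.span (Set.range s) : Set (X₁.presheaf.stalk x)))) → y ∈ Ideal.span (Set.range s)) →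
    ∀ (U : X₁.affineOpens) (hbU : b ∈ (U : X₁.Opens))
    (n : ℕ) (J : Finset (Fin n))
    (A : Finset (Fin n →₀ ℕ)), (∀ j ∈ J, ∃ N : ℕ, Finsupp.single j N ∈ A) →
    (∀ a ∈ A, ∃ j ∈ J, 0 < a j) →
    ∀ (t : ℕ), 0 < t → ∀ (m : Fin t → (Fin n →₀ ℕ)),
    (∀ a ∈ A, ∃ (c : Fin t) (K : ℕ), 1 ≤ K ∧ ∃ y ∈ (Ideal.span ((fun b : Fin n →₀ ℕ => (MvPolynomial.monomial b (1 : k) : MvPolynomial (Fin n) k)) '' (A : Set (Fin n →₀ ℕ)))) ^ (K - 1),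
      (MvPolynomial.monomial a (1 : k) : MvPolynomial (Fin n) k) ^ K = MvPolynomial.monomial (m c) 1 * y) →
    ∀ (V : Fin t → Matrix (Fin n) (Fin n) ℕ), (∀ c, IsUnit ((V c).map (Nat.cast : ℕ → ℤ)).det) →
    ∀ (a : Fin t → Fin n → (Fin n →₀ ℕ)), (∀ c i, a c i ∈ A) →
    (∀ (c : Fin t) (i : Fin n), (Finsupp.equivFunOnFinite.symm ((V c).mulVec ⇑(a c i)) : Fin n →₀ ℕ) =
      Finsupp.equivFunOnFinite.symm ((V c).mulVec ⇑(m c)) + Finsupp.single i 1) →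
    (∀ (c : Fin t), ∀ e ∈ A, (Finsupp.equivFunOnFinite.symm ((V c).mulVec ⇑(m c)) : Fin n →₀ ℕ) ≤
      Finsupp.equivFunOnFinite.symm ((V c).mulVec ⇑e)) →
    ∀ (r : ℕ) (Fs : Fin r → MvPolynomial (Fin n) k), (Ideal.span (Set.range Fs)).IsPrime →
    (∀ v : Fin n, Ideal.Quotient.mk (Ideal.span (Set.range Fs)) (MvPolynomial.X v) ≠ 0) →
    ∀ (gs : Fin t → Fin r → MvPolynomial (Fin n) k) (d : Fin t → Fin r → (Fin n →₀ ℕ)),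
    (∀ (c : Fin t) (l : Fin r), aeval (fun j : Fin n => ∏ i : Fin n, (X i : MvPolynomial (Fin n) k) ^ V c i j) (Fs l) =
      monomial (d c l) (1 : k) * gs c l) →
    (∀ (c : Fin t) (l : Fin r), ∃ (N : ℕ) (r' : Fin n →₀ ℕ), N • m c = ∑ j : Fin n, d c l j • a c j + r') →
    (∀ (c : Fin t) (Q' : Ideal (MvPolynomial (Fin n) k ⧸ Ideal.span (Set.range (gs c)))) [Q'.IsMaximal],
      (∀ j ∈ J, Ideal.Quotient.mk (Ideal.span (Set.range (gs c)))
        (aeval (fun j : Fin n => ∏ i : Fin n, (X i : MvPolynomial (Fin n) k) ^ V c i j) (X j : MvPolynomial (Fin n) k)) ∈ Q') →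
        (∀ i : Fin n, (X i : MvPolynomial (Fin n) k) ∈ Q'.comap (Ideal.Quotient.mk (Ideal.span (Set.range (gs c)))) →
          IsSMulRegular (Localization.AtPrime (Q'.comap (Ideal.Quotient.mk (Ideal.span (Set.range (gs c))))) ⧸
              (Ideal.span (Set.range (gs c))).map (algebraMap (MvPolynomial (Fin n) k)
                (Localization.AtPrime (Q'.comap (Ideal.Quotient.mk (Ideal.span (Set.range (gs c))))))))
            (algebraMap (MvPolynomial (Fin n) k)
              (Localization.AtPrime (Q'.comap (Ideal.Quotient.mk (Ideal.span (Set.range (gs c)))))) (X i))) ∧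
        ∀ dd : ℕ, ringKrullDim (Localization.AtPrime Q') = dd → ∀ s : Fin dd → Localization.AtPrime Q',
          (Ideal.span (Set.range s)).radical.IsMaximal →
            RingTheory.Sequence.IsWeaklyRegular (Localization.AtPrime Q') (List.ofFn s) ∧
            ∀ y : Localization.AtPrime Q', (∃ e : ℕ, y ^ p ^ e ∈ Ideal.span
              ((fun z : Localization.AtPrime Q' => z ^ p ^ e) ''
                (Ideal.span (Set.range s) : Set (Localization.AtPrime Q')))) → y ∈ Ideal.span (Set.range s)) →
    (∀ c : Fin t, Ideal.Quotient.mk (Ideal.span (Set.range Fs)) (monomial (m c) (1 : k)) ∈ (Ideal.span ((fun e : Fin n →₀ ℕ => Ideal.Quotient.mk (Ideal.span (Set.range Fs)) (monomial e (1 : k))) '' (A : Set (Fin n →₀ ℕ))))) →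
    (∀ (P : Ideal (MvPolynomial (Fin n) k ⧸ Ideal.span (Set.range Fs))) [P.IsPrime],
      (∀ j ∈ J, Ideal.Quotient.mk (Ideal.span (Set.range Fs)) (MvPolynomial.X j) ∈ P) → ∀ i : Fin n, Ideal.Quotient.mk (Ideal.span (Set.range Fs)) (MvPolynomial.X i) ∈ P) →
    ∀ (h : (MvPolynomial (Fin n) k ⧸ Ideal.span (Set.range Fs))), h ≠ 0 → ∀ (ε : Γ(X₁, U) ≃+* Localization.Away h),
    Ideal.comap ((ε.symm : Localization.Away h →+* Γ(X₁, U)).comp (algebraMap (MvPolynomial (Fin n) k ⧸ Ideal.span (Set.range Fs)) (Localization.Away h))) (U.2.primeIdealOf ⟨b, hbU⟩).asIdeal =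
        Ideal.span (Set.range fun i : Fin n => Ideal.Quotient.mk (Ideal.span (Set.range Fs)) (MvPolynomial.X i)) →
    ∀ W : X₁.Opens, b ∈ W → ∃ U : X₁.affineOpens, (U : X₁.Opens) ≤ W ∧ b ∈ (U : X₁.Opens) ∧
      (∀ x : X₁, x ∈ (U : X₁.Opens) → x ≠ b → ∀ d : ℕ, ringKrullDim (X₁.presheaf.stalk x) = d → ∀ s : Fin d → X₁.presheaf.stalk x, (Ideal.span (Set.range s)).radical.IsMaximal → ∀ y : X₁.presheaf.stalk x, (∃ e : ℕ, y ^ p ^ e ∈ Ideal.span ((fun z : X₁.presheaf.stalk x => z ^ p ^ e) '' (Ideal.span (Set.range s) : Set (X₁.presheaf.stalk x)))) → y ∈ Ideal.span (Set.range s)) ∧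
      CharP Γ(X₁, U) p ∧ ∃ (I : Ideal Γ(X₁, U)), I ≠ ⊥ ∧
      (∀ (x : X₁) (hx : x ∈ (U : X₁.Opens)), I ≤ (U.2.primeIdealOf ⟨x, hx⟩).asIdeal ↔ x = b) ∧
      ∃ (t : ℕ) (v : Fin t → Γ(X₁, U)) (hv : ∀ j : Fin t, v j ∈ I),
        (HomogeneousIdeal.irrelevant (reesGrading I)).toIdeal ≤ (Ideal.span (Set.range fun j : Fin t => reesT (I := I) (v j) (hv j))).radical ∧
        (∀ j : Fin t, v j ≠ 0) ∧
        ∀ (j : Fin t) (Q : Ideal (Literature.AlgebraicGeometry.Resolution.blowupAlgebra I (v j))) [Q.IsMaximal],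
          algebraMap Γ(X₁, U) (Literature.AlgebraicGeometry.Resolution.blowupAlgebra I (v j)) (v j) ∈ Q →
          ∀ d : ℕ, ringKrullDim (Localization.AtPrime Q) = d → ∀ s : Fin d → Localization.AtPrime Q, (Ideal.span (Set.range s)).radical.IsMaximal → RingTheory.Sequence.IsWeaklyRegular (Localization.AtPrime Q) (List.ofFn s) ∧ ∀ y : Localization.AtPrime Q, (∃ e : ℕ, y ^ p ^ e ∈ Ideal.span ((fun z : Localization.AtPrime Q => z ^ p ^ e) '' (Ideal.span (Set.range s) : Set (Localization.AtPrime Q)))) → y ∈ Ideal.span (Set.range s) := by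
  intro p _ k _ _ X₁ _ b hb V₀ hbV₀ hV₀ U hbU n J A hprim hAJ t ht m hcov V hV a haA hgen hge r Fs hprime hXne gs d hθF hunit
    hon' hv hJ h hh ε hbm
  classical
  haveI := hprime
  haveI : IsDomain (MvPolynomial (Fin n) k ⧸ Ideal.span (Set.range Fs)) := Ideal.Quotient.isDomain _
  haveI : CharP (MvPolynomial (Fin n) k ⧸ Ideal.span (Set.range Fs)) p :=
    charP_of_injective_algebraMap (algebraMap k (MvPolynomial (Fin n) k ⧸ Ideal.span (Set.range Fs))).injective p
  obtain ⟨hcov', hv0, hon⟩ :=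
    CICertificates.ciCertificates p k J A hprim t m hcov V hV a haA hgen hge Fs hprime hXne gs d hθF hunit hon' hv
  have hI : Ideal.span ((fun e : Fin n →₀ ℕ => Ideal.Quotient.mk (Ideal.span (Set.range Fs)) (monomial e (1 : k))) '' (A : Set (Fin n →₀ ℕ))) ≠ ⊥ := by
    intro h0
    apply hv0 ⟨0, ht⟩
    have hmem := hv ⟨0, ht⟩
    rw [h0] at hmem
    exact (Submodule.mem_bot _).mp hmem
  refine CertifiedChartOfAwayChart.certifiedChart_of_awayChartEquiv p X₁ b hb V₀ hbV₀ hV₀ U hbU (MvPolynomial (Fin n) k ⧸ Ideal.span (Set.range Fs)) _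
    (Ideal.span (Set.range fun i : Fin n => Ideal.Quotient.mk (Ideal.span (Set.range Fs)) (MvPolynomial.X i))) h hh ε hI (fun P hP => ?_) hbm ⟨t, _, hv, hcov', hv0, hon⟩
  haveI := hP
  rw [CICertificates.centre_le_iff _ J A hAJ hprim P]
  constructor
  · intro hX
    rw [Ideal.span_le, Set.range_subset_iff]
    exact hJ P hX
  · intro hm j _
    exact hm (Ideal.subset_span ⟨j, rfl⟩)

set_option maxHeartbeats 800000 in
-- large binder block
/-- **THE DOOR COROLLARY FOR c.i.-CN CHART MODELS** (road B): an admissible pair `(X₁, f₁)` (separated, locally of finite type,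
quasi-compact over `k` of characteristic `p`; `X₁` integral, everywhere Cohen–Macaulay, finite F-bad set) each of whose bad points
carries an affine open `U ∋ b` with `Γ(X₁, U) ≃+* (k[X]/(Fs))[1/h]` pulling the prime of `b` back to `(x̄)`, for SOME c.i.-CN datum
per point (binders of `CICertificates.ciCertificates` + `hAJ` + point support `hJ`), has the crux's model. ZERO named facts:
`OfChartModels.fInjectiveMacaulayfication_of_certifiedAwayCharts` fed with `ciCertificates`. [folklore] -/
theorem fInjectiveMacaulayfication_of_ciChartModels (p : ℕ) (hp : p.Prime) (k : Type) [Field k] [CharP k p]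
    (X₁ : Scheme.{0}) (f₁ : X₁ ⟶ Spec (.of k)) (hsep : IsSeparated f₁) (hft : LocallyOfFiniteType f₁) (hqc : QuasiCompact f₁)
    (hint : IsIntegral X₁) (hCM : ∀ x : X₁, ∀ d : ℕ, ringKrullDim (X₁.presheaf.stalk x) = d → ∀ s : Fin d → X₁.presheaf.stalk x, (Ideal.span (Set.range s)).radical.IsMaximal → RingTheory.Sequence.IsWeaklyRegular (X₁.presheaf.stalk x) (List.ofFn s))
    (hfin : Set.Finite {x : X₁ | ¬ ∀ d : ℕ, ringKrullDim (X₁.presheaf.stalk x) = d → ∀ s : Fin d → X₁.presheaf.stalk x, (Ideal.span (Set.range s)).radical.IsMaximal → ∀ y : X₁.presheaf.stalk x, (∃ e : ℕ, y ^ p ^ e ∈ Ideal.span ((fun z : X₁.presheaf.stalk x => z ^ p ^ e) '' (Ideal.span (Set.range s) : Set (X₁.presheaf.stalk x)))) → y ∈ Ideal.span (Set.range s)})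
    (hchart : ∀ b : X₁, (¬ ∀ d : ℕ, ringKrullDim (X₁.presheaf.stalk b) = d → ∀ s : Fin d → X₁.presheaf.stalk b, (Ideal.span (Set.range s)).radical.IsMaximal → ∀ y : X₁.presheaf.stalk b, (∃ e : ℕ, y ^ p ^ e ∈ Ideal.span ((fun z : X₁.presheaf.stalk b => z ^ p ^ e) '' (Ideal.span (Set.range s) : Set (X₁.presheaf.stalk b)))) → y ∈ Ideal.span (Set.range s)) →
      ∃ (U : X₁.affineOpens) (hbU : b ∈ (U : X₁.Opens)) (n : ℕ) (J : Finset (Fin n)) (A : Finset (Fin n →₀ ℕ))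
        (_ : ∀ j ∈ J, ∃ N : ℕ, Finsupp.single j N ∈ A) (_ : ∀ a ∈ A, ∃ j ∈ J, 0 < a j)
        (t : ℕ) (_ : 0 < t) (m : Fin t → (Fin n →₀ ℕ))
        (_ : ∀ a ∈ A, ∃ (c : Fin t) (K : ℕ), 1 ≤ K ∧ ∃ y ∈ (Ideal.span ((fun b : Fin n →₀ ℕ => (MvPolynomial.monomial b (1 : k) : MvPolynomial (Fin n) k)) '' (A : Set (Fin n →₀ ℕ)))) ^ (K - 1),
          (MvPolynomial.monomial a (1 : k) : MvPolynomial (Fin n) k) ^ K = MvPolynomial.monomial (m c) 1 * y)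
        (V : Fin t → Matrix (Fin n) (Fin n) ℕ) (_ : ∀ c, IsUnit ((V c).map (Nat.cast : ℕ → ℤ)).det)
        (a : Fin t → Fin n → (Fin n →₀ ℕ)) (_ : ∀ c i, a c i ∈ A)
        (_ : ∀ (c : Fin t) (i : Fin n), (Finsupp.equivFunOnFinite.symm ((V c).mulVec ⇑(a c i)) : Fin n →₀ ℕ) =
          Finsupp.equivFunOnFinite.symm ((V c).mulVec ⇑(m c)) + Finsupp.single i 1)
        (_ : ∀ (c : Fin t), ∀ e ∈ A, (Finsupp.equivFunOnFinite.symm ((V c).mulVec ⇑(m c)) : Fin n →₀ ℕ) ≤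
          Finsupp.equivFunOnFinite.symm ((V c).mulVec ⇑e))
        (r : ℕ) (Fs : Fin r → MvPolynomial (Fin n) k) (_ : (Ideal.span (Set.range Fs)).IsPrime)
        (_ : ∀ v : Fin n, Ideal.Quotient.mk (Ideal.span (Set.range Fs)) (MvPolynomial.X v) ≠ 0)
        (gs : Fin t → Fin r → MvPolynomial (Fin n) k) (d : Fin t → Fin r → (Fin n →₀ ℕ))
        (_ : ∀ (c : Fin t) (l : Fin r), aeval (fun j : Fin n => ∏ i : Fin n, (X i : MvPolynomial (Fin n) k) ^ V c i j) (Fs l) =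
          monomial (d c l) (1 : k) * gs c l)
        (_ : ∀ (c : Fin t) (l : Fin r), ∃ (N : ℕ) (r' : Fin n →₀ ℕ), N • m c = ∑ j : Fin n, d c l j • a c j + r')
        (_ : ∀ (c : Fin t) (Q' : Ideal (MvPolynomial (Fin n) k ⧸ Ideal.span (Set.range (gs c)))) [Q'.IsMaximal],
          (∀ j ∈ J, Ideal.Quotient.mk (Ideal.span (Set.range (gs c)))
            (aeval (fun j : Fin n => ∏ i : Fin n, (X i : MvPolynomial (Fin n) k) ^ V c i j) (X j : MvPolynomial (Fin n) k)) ∈ Q') →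
            (∀ i : Fin n, (X i : MvPolynomial (Fin n) k) ∈ Q'.comap (Ideal.Quotient.mk (Ideal.span (Set.range (gs c)))) →
              IsSMulRegular (Localization.AtPrime (Q'.comap (Ideal.Quotient.mk (Ideal.span (Set.range (gs c))))) ⧸
                  (Ideal.span (Set.range (gs c))).map (algebraMap (MvPolynomial (Fin n) k)
                    (Localization.AtPrime (Q'.comap (Ideal.Quotient.mk (Ideal.span (Set.range (gs c))))))))
                (algebraMap (MvPolynomial (Fin n) k)
                  (Localization.AtPrime (Q'.comap (Ideal.Quotient.mk (Ideal.span (Set.range (gs c)))))) (X i))) ∧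
            ∀ dd : ℕ, ringKrullDim (Localization.AtPrime Q') = dd → ∀ s : Fin dd → Localization.AtPrime Q',
              (Ideal.span (Set.range s)).radical.IsMaximal →
                RingTheory.Sequence.IsWeaklyRegular (Localization.AtPrime Q') (List.ofFn s) ∧
                ∀ y : Localization.AtPrime Q', (∃ e : ℕ, y ^ p ^ e ∈ Ideal.span
                  ((fun z : Localization.AtPrime Q' => z ^ p ^ e) ''
                    (Ideal.span (Set.range s) : Set (Localization.AtPrime Q')))) → y ∈ Ideal.span (Set.range s))
        (_ : ∀ c : Fin t, Ideal.Quotient.mk (Ideal.span (Set.range Fs)) (monomial (m c) (1 : k)) ∈ (Ideal.span ((fun e : Fin n →₀ ℕ => Ideal.Quotient.mk (Ideal.span (Set.range Fs)) (monomial e (1 : k))) '' (A : Set (Fin n →₀ ℕ)))))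
        (_ : ∀ (P : Ideal (MvPolynomial (Fin n) k ⧸ Ideal.span (Set.range Fs))) [P.IsPrime],
          (∀ j ∈ J, Ideal.Quotient.mk (Ideal.span (Set.range Fs)) (MvPolynomial.X j) ∈ P) → ∀ i : Fin n, Ideal.Quotient.mk (Ideal.span (Set.range Fs)) (MvPolynomial.X i) ∈ P)
        (h : (MvPolynomial (Fin n) k ⧸ Ideal.span (Set.range Fs))) (_ : h ≠ 0) (ε : Γ(X₁, U) ≃+* Localization.Away h),
        Ideal.comap ((ε.symm : Localization.Away h →+* Γ(X₁, U)).comp (algebraMap (MvPolynomial (Fin n) k ⧸ Ideal.span (Set.range Fs)) (Localization.Away h))) (U.2.primeIdealOf ⟨b, hbU⟩).asIdeal =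
          Ideal.span (Set.range fun i : Fin n => Ideal.Quotient.mk (Ideal.span (Set.range Fs)) (MvPolynomial.X i))) :
    ∃ (X' : Scheme.{0}) (π : X' ⟶ X₁), IsProper π ∧ Literature.AlgebraicGeometry.Resolution.IsBirational π ∧
      ∀ x : X', IsDomain (X'.presheaf.stalk x) ∧ ∀ d : ℕ, ringKrullDim (X'.presheaf.stalk x) = d → ∀ s : Fin d → X'.presheaf.stalk x, (Ideal.span (Set.range s)).radical.IsMaximal → RingTheory.Sequence.IsWeaklyRegular (X'.presheaf.stalk x) (List.ofFn s) ∧ ∀ y : X'.presheaf.stalk x, (∃ e : ℕ, y ^ p ^ e ∈ Ideal.span ((fun z : X'.presheaf.stalk x => z ^ p ^ e) '' (Ideal.span (Set.range s) : Set (X'.presheaf.stalk x)))) → y ∈ Ideal.span (Set.range s) := by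
  haveI : Fact p.Prime := ⟨hp⟩
  refine OfChartModels.fInjectiveMacaulayfication_of_certifiedAwayCharts p hp k X₁ f₁ hsep hft hqc hint hCM hfin fun b hbad => ?_
  obtain ⟨U, hbU, n, J, A, hprim, hAJ, t, ht, m, hcov, V, hV, a, haA, hgen, hge, r, Fs, hprime, hXne, gs, d, hθF, hunit, hon', hv,
    hJ, h, hh, ε, hbm⟩ := hchart b hbad
  classical
  haveI := hprime
  haveI : IsDomain (MvPolynomial (Fin n) k ⧸ Ideal.span (Set.range Fs)) := Ideal.Quotient.isDomain _
  haveI : CharP (MvPolynomial (Fin n) k ⧸ Ideal.span (Set.range Fs)) p :=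
    charP_of_injective_algebraMap (algebraMap k (MvPolynomial (Fin n) k ⧸ Ideal.span (Set.range Fs))).injective p
  obtain ⟨hcov', hv0, hon⟩ :=
    CICertificates.ciCertificates p k J A hprim t m hcov V hV a haA hgen hge Fs hprime hXne gs d hθF hunit hon' hv
  have hI : Ideal.span ((fun e : Fin n →₀ ℕ => Ideal.Quotient.mk (Ideal.span (Set.range Fs)) (monomial e (1 : k))) '' (A : Set (Fin n →₀ ℕ))) ≠ ⊥ := by
    intro h0
    apply hv0 ⟨0, ht⟩
    have hmem := hv ⟨0, ht⟩
    rw [h0] at hmem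
    exact (Submodule.mem_bot _).mp hmem
  refine ⟨U, hbU, (MvPolynomial (Fin n) k ⧸ Ideal.span (Set.range Fs)), inferInstance, inferInstance, inferInstance, inferInstance, _,
    Ideal.span (Set.range fun i : Fin n => Ideal.Quotient.mk (Ideal.span (Set.range Fs)) (MvPolynomial.X i)), h, hh, ε, hI, fun P hP => ?_, hbm, t, _, hv, hcov', hv0, hon⟩
  haveI := hP
  rw [CICertificates.centre_le_iff _ J A hAJ hprim P]
  constructor
  · intro hX
    rw [Ideal.span_le, Set.range_subset_iff]
    exact hJ P hX
  · intro hm j _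
    exact hm (Ideal.subset_span ⟨j, rfl⟩)

end Summit.ResolutionOfSingularities.ResolutionOfSingularities.Theorems.FInjectiveMacaulayfication.OfCIChartModels

end
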